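import Summits.AnomalousDissipation.AnomalousDissipation.Theorems.SolenoidalFractalHomogenisationLagrangianStepZ7GlueDefs
import Summits.AnomalousDissipation.AnomalousDissipation.Theorems.SolenoidalFractalHomogenisationLagrangianStepZ7GlueCompose
import HarnessLib

/-!
# K1L_D (stmt-AnomalousDissipation-27980), §9z glue v2, step (a): the EULERIAN loss-currency bound on ONE refresh piece from (V_modEC) and the
# frame conjugacy (helper; `--supports … --as helper`; lead-k1l-onelevel-p1 g5; memo L12 §3(a), tenure D26-15)

On a refresh piece `[s,t]` starting at a frame reset, `FrameConjugacyAt … Cα ϱ E m S Um1 Um s t` (p694968) provides the modulation datum `G`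
(`θ ≤ Cα·θ(m+1)`, `nC ≤ ϱ·N m`), the distorted propagators `Ut, Tt` (frame conjugates of the true / coarse window maps) and the unitary readings
`ι, ι'`.  Instantiating the capped modulated cell clause `CellClauseMod.SlowVectorClauseModEC` (p692853) at the (V)-family member
`(ν, n, 𝔸) = (cellVisc(m+1), N(m+1), ν•S)` (`λ = 1`), on the cell-time window `[0, a(t−s)]`, at the data `(ι x, ι' y)`, and reading the result back
through the conjugacy and the two loss identities gives, for weakly divergence-free `x, y` and then for all `x, y` (`Z7Glue.lossBound_of_divFree_propagator`,
p694610), the EULERIAN bound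

  `|⟪Um1 s t x − Um s t x, y⟫| ≤ η̄(t−s) · √lossFwd (Um s t) x · √lossAdj (Um s t) y`,
  `η̄(τ) = Cm·(Cm·(ν^σ + (⌈K/ν⌉/n)^σ + (Cα·θ(m+1))^σ + (ϱ·N m/n)^σ) + (min 1 ((M·Wp/ν)/(a·τ)))^σ)`

(`eulerian_piece`), under the side conditions of the clause (`ν < ν₀`, `⌈K/ν⌉ ≤ n`, `Cα·θ(m+1) ≤ θ₁`, `ϱ·N m ≤ ϱ₁·n`), which the assembly
`…Z7Glue` discharges from the template.  NOT a proof of §9z, of the crux, or of AD; rung F-D1.A0.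
-/

set_option linter.dupNamespace false  -- the summit-side namespace `Summit.AnomalousDissipation.AnomalousDissipation.…` repeats a component by design (D-0017)

noncomputable section

namespace Summit.AnomalousDissipation.AnomalousDissipation.Theorems.SolenoidalFractalHomogenisation.LagrangianStep.Z7Glue

open Literature.Analysis Literature.Analysis.FluidPDE Literature.Analysis.FunctionSpaces
open MeasureTheory Set
open scoped InnerProductSpace
open Literature.Analysis.FluidPDE.LatticeShear (LagrangianLatticeCarrier LatticeWord)
open Summit.AnomalousDissipation.AnomalousDissipation.Theorems.SolenoidalFractalHomogenisation.LagrangianStep.CellClauseMod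

/-- Monotonicity of the (V_modEC) error functional in the distortion and the modulation wavenumber. -/
theorem eta_mono {Cm σ A B θ θ' r r' T : ℝ} (hCm : 0 ≤ Cm) (hσ : 0 ≤ σ) (hθ : 0 ≤ θ) (hθ' : θ ≤ θ') (hr : 0 ≤ r) (hr' : r ≤ r') :
    Cm * (Cm * (A + B + θ ^ σ + r ^ σ) + T) ≤ Cm * (Cm * (A + B + θ' ^ σ + r' ^ σ) + T) := by
  have h1 : θ ^ σ ≤ θ' ^ σ := Real.rpow_le_rpow hθ hθ' hσ
  have h2 : r ^ σ ≤ r' ^ σ := Real.rpow_le_rpow hr hr' hσ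
  have h3 : Cm * (A + B + θ ^ σ + r ^ σ) ≤ Cm * (A + B + θ' ^ σ + r' ^ σ) := mul_le_mul_of_nonneg_left (by linarith) hCm
  exact mul_le_mul_of_nonneg_left (by linarith) hCm

/-- **Step (a): the Eulerian loss-currency bound on one refresh piece.**  See the module docstring. -/
theorem eulerian_piece {k : ℕ} {W : LatticeWord k} {M : ℝ} {hM : 0 < M} {c : ℝ}
    {Φ : ℝ → Torus.Visc4 (Fin 3) → Torus.Visc4 (Fin 3)} {lo hi Λ β σ Cm ν₀ K θ₁ ϱ₁ Cα ϱ : ℝ}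
    {E : LagrangianLatticeCarrier k} {m : ℕ} {S : Torus.Visc4 (Fin 3)} {Um1 Um : ℝ → ℝ → (V2 →L[ℝ] V2)} {s t : ℝ}
    {bm bm1 : ℝ → VF} {𝔸m 𝔸m1 : Torus.Visc4 (Fin 3)} {T₀ : ℝ}
    (hMod : SlowVectorClauseModEC W M hM c Φ lo hi Λ β σ Cm ν₀ K θ₁ ϱ₁)
    (hFC : FrameConjugacyAt W M hM c Φ Cα ϱ E m S Um1 Um s t)
    (hUm : Torus.IsPropagator T₀ bm 𝔸m Um) (hUm1 : Torus.IsPropagator T₀ bm1 𝔸m1 Um1)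
    (hst : s < t) (hσ : 0 < σ) (hCm : 0 ≤ Cm) (hΛ : 1 ≤ Λ) (hϱ : 0 ≤ ϱ)
    (hνν₀ : E.cellVisc (m + 1) < ν₀) (hKn : (⌈K / E.cellVisc (m + 1)⌉₊ : ℝ) ≤ E.N (m + 1))
    (hθθ₁ : Cα * E.θ (m + 1) ≤ θ₁) (hϱϱ₁ : ϱ * E.N m ≤ ϱ₁ * E.N (m + 1))
    (hSo : Torus.OddSmall S β) (hSn : Torus.NearIso S lo hi) :
    ∀ x y : V2, |⟪Um1 s t x - Um s t x, y⟫_ℝ|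
      ≤ (Cm * (Cm * (E.cellVisc (m + 1) ^ σ + ((⌈K / E.cellVisc (m + 1)⌉₊ : ℝ) / E.N (m + 1)) ^ σ
            + (Cα * E.θ (m + 1)) ^ σ + (ϱ * E.N m / E.N (m + 1)) ^ σ)
          + (min 1 ((M * W.period / E.cellVisc (m + 1)) / (E.a (m + 1) * (t - s)))) ^ σ))
        * Real.sqrt (lossFwd (Um s t) x) * Real.sqrt (lossAdj (Um s t) y) := by
  obtain ⟨hν, θ, hθ0, hθle, nC, hnC0, hnCle, G, hG, Ut, Tt, hUt, hTt, ι, ι', hconj, hlossF, hlossA⟩ := hFC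
  -- abbreviations
  set ν : ℝ := E.cellVisc (m + 1) with hν_def
  set Tw : ℝ := E.a (m + 1) * (t - s) with hTw_def
  have hνI : ν ∈ Set.Ioo 0 ν₀ := ⟨hν.1, hνν₀⟩
  have ha : 0 < E.a (m + 1) := E.a_pos (m + 1)
  have hTw : 0 < Tw := mul_pos ha (by linarith)
  have hn : (0:ℝ) < E.N (m + 1) := by exact_mod_cast E.N_pos (m + 1)
  -- the (V)-family member `𝔸 = ν • S`, `λ = 1`
  have hodd : Torus.OddSmall (ν • S) (ν * β) := hSo.smul ν
  have hwin : ∃ lam ∈ Set.Icc (1:ℝ) Λ, Torus.NearIso (ν • S) (ν * (lo / lam)) (ν * (hi * lam)) :=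
    ⟨1, ⟨le_rfl, hΛ⟩, nearIso_congr (hSn.smul hν.1.le) (by rw [div_one]) (by rw [mul_one])⟩
  have hθI : θ ∈ Set.Icc 0 θ₁ := ⟨hθ0, hθle.trans hθθ₁⟩
  have hnCn : nC ≤ ϱ₁ * (E.N (m + 1) : ℕ) := hnCle.trans hϱϱ₁
  -- the clause, at the frame data
  have key := hMod ν hνI (E.N (m + 1)) hKn (ν • S) hodd hwin θ hθI nC hnC0 hnCn Tw hTw G hG Ut Tt hUt hTt 0 Tw le_rfl hTw le_rfl
  rw [sub_zero] at key
  -- the error functional and its monotone envelope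
  set η : ℝ := Cm * (Cm * (ν ^ σ + ((⌈K / ν⌉₊ : ℝ) / (E.N (m + 1) : ℕ)) ^ σ + θ ^ σ + (nC / (E.N (m + 1) : ℕ)) ^ σ)
      + (min 1 ((M * W.period / ν) / Tw)) ^ σ) with hη_def
  set ηbar : ℝ := Cm * (Cm * (ν ^ σ + ((⌈K / ν⌉₊ : ℝ) / E.N (m + 1)) ^ σ + (Cα * E.θ (m + 1)) ^ σ + (ϱ * E.N m / E.N (m + 1)) ^ σ)
      + (min 1 ((M * W.period / ν) / Tw)) ^ σ) with hηbar_def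
  have hηle : η ≤ ηbar := by
    rw [hη_def, hηbar_def]
    exact eta_mono hCm hσ.le hθ0 hθle (div_nonneg hnC0 hn.le) (div_le_div_of_nonneg_right hnCle hn.le)
  have hηbar0 : 0 ≤ ηbar := by
    rw [hηbar_def]
    have h1 : 0 ≤ ν ^ σ := Real.rpow_nonneg hν.1.le σ
    have h2 : 0 ≤ ((⌈K / ν⌉₊ : ℝ) / E.N (m + 1)) ^ σ := Real.rpow_nonneg (by positivity) σ
    have h3 : 0 ≤ (Cα * E.θ (m + 1)) ^ σ := Real.rpow_nonneg (hθ0.trans hθle) σ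
    have h4 : 0 ≤ (ϱ * E.N m / E.N (m + 1)) ^ σ := Real.rpow_nonneg (by positivity) σ
    have hWp : 0 < W.period := PermissibleCarrier.period_pos W
    have h5 : 0 ≤ (min 1 ((M * W.period / ν) / Tw)) ^ σ :=
      Real.rpow_nonneg (le_min zero_le_one (div_nonneg (div_nonneg (mul_nonneg hM.le hWp.le) hν.1.le) hTw.le)) σ
    have : 0 ≤ Cm * (ν ^ σ + ((⌈K / ν⌉₊ : ℝ) / E.N (m + 1)) ^ σ + (Cα * E.θ (m + 1)) ^ σ + (ϱ * E.N m / E.N (m + 1)) ^ σ) :=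
      mul_nonneg hCm (by linarith)
    exact mul_nonneg hCm (by linarith)
  -- divergence-free data: conjugate, apply the clause, read back
  have hdiv : ∀ x y : V2, Torus.IsWeaklyDivFree (⇑x : VF) → Torus.IsWeaklyDivFree (⇑y : VF) →
      |⟪Um1 s t x - Um s t x, y⟫_ℝ| ≤ ηbar * Real.sqrt (lossFwd (Um s t) x) * Real.sqrt (lossAdj (Um s t) y) := by
    intro x y hx hy
    rw [hconj x y hx hy, ← hlossF x hx, ← hlossA y hy]
    refine (key (ι x) (ι' y)).trans ?_
    exact mul_le_mul (mul_le_mul_of_nonneg_right hηle (Real.sqrt_nonneg _)) le_rfl (Real.sqrt_nonneg _)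
      (mul_nonneg hηbar0 (Real.sqrt_nonneg _))
  -- all data
  exact lossBound_of_divFree_propagator hUm hUm1 s t hηbar0 hdiv

end Summit.AnomalousDissipation.AnomalousDissipation.Theorems.SolenoidalFractalHomogenisation.LagrangianStep.Z7Glue

end
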